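import Summits.HodgeConjecture.CorCM.MultiFieldWeilSimpleFamiliesAnyCurve
import Summits.HodgeConjecture.CorCM.MultiFieldWeilAnyTwoSimpleThreefoldsAnyCurves
import HarnessLib

/-!
# MULTI-FIELD WEIL ENGINE — A CUBIC TOWER OF SIMPLE CM THREEFOLDS OVER `k` AND ANY FINITE FAMILY OF CM ELLIPTIC CURVES: the Hodge conjecture for every
# `∏_m T_m^{b_m} × ∏_c E_c^{n_c}`, given ONLY Markman's fourfold theorem

Cell `pub-hodgecm2` (COR-CM), seat b30 gen 34 (2026-08-25); count-neutral own lane MULTI-FIELD WEIL ENGINE (stem `MultiFieldWeil*`), sequel of gen 33's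
`CorCM/MultiFieldWeilSimpleFamiliesAnyCurve.lean` (S7: the tower and ONE CM elliptic curve, of any field) and `CorCM/MultiFieldWeilSimpleFamiliesStandalone.lean` (S3: the tower
alone).  Theorems only; no definition, no named fact, no `sorry`.  HONEST FRAMING: conditional on the displayed Markman fourfold binder only; `HC_CM` is NOT proved and not
asserted.

THE STATEMENT (**`hodgeConjectureFor_prod_simpleThreefolds_of_cubicTower_anyCurves_of_markman`**).  `k` imaginary quadratic with `i_m : k ↪ K_m`, `T_m ⊨ (K_m; Φ_m)` (`m < r`)
SIMPLE CM threefolds over sextic fields in a CUBIC TOWER (`htower`: no `τ`-embedding of `K_m` lands in `ℚ(τk)·s_0(K_0)⋯s_{m−1}(K_{m−1})`), `E_c ⊨ (k_c; Ψ_c)` (`c ∈ I`, finite) ANY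
CM elliptic curves — isogenous or not, of any fields.  Then for every `π : Fin N → Fin r ⊕ I` the Hodge conjecture holds for `⨁_j Sum.elim T E (π j)` — every
`∏_m T_m^{b_m} × ∏_c E_c^{n_c}` — GIVEN ONLY `Markman2025_weilClasses_algebraic_abelianFourfold`; with the dominated form.

PROOF.  Representatives of the isogeny classes of the curves (§2), so the curve fields are pairwise non-isomorphic; then at most ONE curve `E_a` has `k_a ≅ k`, and every
other curve is FOREIGN to every `K_m` (a sextic field through `k` has no second quadratic subfield, b16's `WeilFibre.nonempty_algEquiv_of_finrank_eq_two`) and to `k_a`,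
so the block of those splits off (gen 33's `hodgeConjectureFor_prod_of_foreignCurves`, unconditional; inside: b16's `hodgeConjectureFor_prod_of_pairwise_not_isIsogenous`);
the rest `{T_0, …, T_{r−1}, E_a}` is S7 on `Fin.cons E_a T` (or S3 when no curve field is `≅ k`) (§1).

[cite: MoonenZarhin1999LowDim, Thm. (0.1) (a), §3 (3.1), Cor. (3.9), §5 (5.2)] [cite: Markman2025SurveySecant, Thm. 1.2] [cite: Gordon1999HodgeAVSurvey, §3 Theorem (proof), 7.4–7.7]
[cite: Shimura1998, §6.1 Corollary of Theorem 2 (p. 41), §8.2 Prop. 26, §18.2 Lemma (i)] [cite: MumfordAV1970, §19 Thm. 1 and p. 169]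

## References
* [MoonenZarhin1999LowDim] B. Moonen, Yu. Zarhin, Math. Ann. 315 (1999) 711–733.  [Markman2025SurveySecant] E. Markman, arXiv:2509.23403, Thm. 1.2.
  [Gordon1999HodgeAVSurvey] B. B. Gordon, *A survey of the Hodge conjecture for abelian varieties*, §3, 7.4–7.7.  [Shimura1998] G. Shimura, *Abelian varieties with
  complex multiplication and modular functions*, §6.1, §8.2, §18.2.  [MumfordAV1970] D. Mumford, *Abelian Varieties*, §19.
-/

noncomputable section

open CategoryTheory CategoryTheory.Limits NumberField IntermediateField

namespace Summit.HodgeConjecture.CorCM.MultiFieldWeil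

open Literature.AlgebraicGeometry Literature.AlgebraicGeometry.Motives Literature.AlgebraicGeometry.HodgeTheory
open Literature.AlgebraicGeometry.ComplexMultiplication (IsCMTypeRealisation)
open Literature.AlgebraicTopology.SingularHomology
open Literature.NumberTheory.ComplexMultiplication

open scoped Classical

section TowerCurves

variable {r : ℕ} {k : Type} [fk : Field k] [nk : NumberField k] [ck : IsCMField k]
  {K : Fin r → Type} [fK : ∀ m, Field (K m)] [nK : ∀ m, NumberField (K m)] [cK : ∀ m, IsCMField (K m)]
  {T : Fin r → AbelianVariety ℂ} {Φ : ∀ m : Fin r, CMType (K m)} {ι : ∀ m, 𝓞 (K m) →+* End (T m)} {θ : ∀ m, K m →+* Module.End ℂ (complexBetti (T m).X 1)}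
  {I : Type} [Fintype I] {kq : I → Type} [fq : ∀ a, Field (kq a)] [nq : ∀ a, NumberField (kq a)] [cq : ∀ a, IsCMField (kq a)]
  {E : I → AbelianVariety ℂ} {Ψ : ∀ a, CMType (kq a)} {ιE : ∀ a, 𝓞 (kq a) →+* End (E a)} {θE : ∀ a, kq a →+* Module.End ℂ (complexBetti (E a).X 1)}

/-! ## §1 The rest block: the tower and the curves whose field is `≅ k` -/

omit nk ck nK cK [Fintype I] nq cq in
/-- The slots `inl m ↦ T_m`, `inr c ↦ E_c` with every curve slot equal to ONE curve `a`, read on `Fin.cons E_a T` (bookkeeping). [folklore] -/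
theorem sum_elim_tower_eq_cons {a : I} (s : Fin r ⊕ I) (hs : ∀ c, s = Sum.inr c → c = a) :
    (Sum.elim T E s : AbelianVariety ℂ) = (Fin.cons (E a) T : Fin (r + 1) → AbelianVariety ℂ) (Sum.elim Fin.succ (fun _ => 0) s) := by
  rcases s with m | c
  · show T m = (Fin.cons (E a) T : Fin (r + 1) → AbelianVariety ℂ) m.succ
    rw [Fin.cons_succ]
  · cases hs c rfl
    rfl

omit nk ck nK cK [Fintype I] nq cq in
/-- The slots with NO curve slot, read on `T` (bookkeeping; `r = 0` cannot occur then unless the product is empty). [folklore] -/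
theorem sum_elim_tower_eq (s : Fin r ⊕ I) (hs : ∀ c, s ≠ Sum.inr c) (m₀ : Fin r) :
    (Sum.elim T E s : AbelianVariety ℂ) = T (Sum.elim id (fun _ => m₀) s) := by
  rcases s with m | c
  · rfl
  · exact absurd rfl (hs c)

/-- **THE REST BLOCK.**  The tower `T_0, …, T_{r−1}` over `k`, pairwise non-isogenous CM elliptic curves `E_c`, and a product of copies in which EVERY curve slot `inr c` has
`k_c ≅ k` (`Nonempty (k_c →+* k)`): the Hodge conjecture holds for it, GIVEN ONLY Markman's fourfold theorem — all curve slots carry ONE curve `a` (two would be isogenous), and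
`Fin.cons E_a T` is gen 33's S7 (or `T` alone is S3). [cite: Markman2025SurveySecant, Thm. 1.2] [cite: Shimura1998, §6.1 Corollary of Theorem 2 (p. 41), §18.2 Lemma (i)] -/
theorem hodgeConjectureFor_prod_sum_tower_of_forall_ringHom_of_markman (hW4 : Markman2025_weilClasses_algebraic_abelianFourfold) (h2 : Module.finrank ℚ k = 2)
    (h6 : ∀ m, Module.finrank ℚ (K m) = 6) (i : ∀ m, k →+* K m) (hT : ∀ m, IsCMTypeRealisation (Φ m) (T m) (ι m) (θ m)) (hS : ∀ m, (T m).IsSimple)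
    (τ : k →+* ℂ) (s : ∀ m, K m →+* ℂ) (hs : ∀ m, (s m).comp (i m) = τ)
    (htower : ∀ (m : Fin r) (φ : K m →+* ℂ), φ.comp (i m) = τ →
      ¬ Set.range φ ⊆ (↑(adjoin ℚ (Set.range τ) ⊔ adjoin ℚ (⋃ j : {j : Fin r // j < m}, Set.range (s j.1))) : Set ℂ))
    (hq2 : ∀ a, Module.finrank ℚ (kq a) = 2) (hE : ∀ a, IsCMTypeRealisation (Ψ a) (E a) (ιE a) (θE a))
    (hni : ∀ a b, a ≠ b → ¬ AbelianVariety.IsIsogenous (E a) (E b)) (hr : 0 < r) {M : ℕ} (ρ : Fin M → Fin r ⊕ I)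
    (hρ : ∀ l c, ρ l = Sum.inr c → Nonempty (kq c →+* k)) :
    HodgeConjectureFor (⨁ fun l => (Sum.elim T E (ρ l) : AbelianVariety ℂ)).dim (⨁ fun l => (Sum.elim T E (ρ l) : AbelianVariety ℂ)).X := by
  -- two curves with fields `≅ k` are isogenous, hence equal
  have huniq : ∀ a b, Nonempty (kq a →+* k) → Nonempty (kq b →+* k) → a = b := by
    rintro a b ⟨fa⟩ ⟨fb⟩
    by_contra hab
    obtain ⟨ea⟩ := exists_ringEquiv_of_ringHom_of_finrank_eq fa ((hq2 a).trans h2.symm)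
    obtain ⟨eb⟩ := exists_ringEquiv_of_ringHom_of_finrank_eq fb ((hq2 b).trans h2.symm)
    exact hni a b hab (isIsogenous_of_ringEquiv (hq2 a) (hE a) (hE b) (eb.trans ea.symm))
  by_cases hex : ∃ a, Nonempty (kq a →+* k)
  · obtain ⟨a, ha⟩ := hex
    have hsl : ∀ l c, ρ l = Sum.inr c → c = a := fun l c h => huniq c a (hρ l c h) ha
    have hfun : (fun l => (Sum.elim T E (ρ l) : AbelianVariety ℂ)) =
        fun l => (Fin.cons (E a) T : Fin (r + 1) → AbelianVariety ℂ) (Sum.elim Fin.succ (fun _ => 0) (ρ l)) := funext fun l => sum_elim_tower_eq_cons (ρ l) (hsl l)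
    rw [hfun]
    exact hodgeConjectureFor_biproduct_cons_anyCurve_simpleThreefolds_of_cubicTower hW4 _ h2 h6 i hT hS τ s hs htower (hq2 a) (hE a)
  · have hsl : ∀ l c, ρ l ≠ Sum.inr c := fun l c h => hex ⟨c, hρ l c h⟩
    have hfun : (fun l => (Sum.elim T E (ρ l) : AbelianVariety ℂ)) = fun l => T (Sum.elim id (fun _ => (⟨0, hr⟩ : Fin r)) (ρ l)) :=
      funext fun l => sum_elim_tower_eq (ρ l) (hsl l) ⟨0, hr⟩
    rw [hfun]
    exact hodgeConjectureFor_biproduct_simpleThreefolds_of_cubicTower hW4 _ h2 h6 i hT hS τ s hs htower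

/-! ## §2 The tower and pairwise non-isogenous curves, then any curves -/

/-- **A CUBIC TOWER OF SIMPLE CM THREEFOLDS OVER `k` WITH ANY NUMBER OF PAIRWISE NON-ISOGENOUS CM ELLIPTIC CURVES — given ONLY Markman's fourfold theorem.**  The curves whose
field is not `≅ k` are FOREIGN to every `K_m` (a sextic field through `k` has no second quadratic subfield) and to the other curve fields, and split off; the rest is §1.
[cite: MoonenZarhin1999LowDim, §3 (3.1), Cor. (3.9)] [cite: Markman2025SurveySecant, Thm. 1.2] [cite: Shimura1998, §18.2 Lemma (i)] -/
theorem hodgeConjectureFor_prod_simpleThreefolds_of_cubicTower_cmCurves_of_markman (hW4 : Markman2025_weilClasses_algebraic_abelianFourfold)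
    (h2 : Module.finrank ℚ k = 2) (h6 : ∀ m, Module.finrank ℚ (K m) = 6) (i : ∀ m, k →+* K m) (hT : ∀ m, IsCMTypeRealisation (Φ m) (T m) (ι m) (θ m))
    (hS : ∀ m, (T m).IsSimple) (τ : k →+* ℂ) (s : ∀ m, K m →+* ℂ) (hs : ∀ m, (s m).comp (i m) = τ)
    (htower : ∀ (m : Fin r) (φ : K m →+* ℂ), φ.comp (i m) = τ →
      ¬ Set.range φ ⊆ (↑(adjoin ℚ (Set.range τ) ⊔ adjoin ℚ (⋃ j : {j : Fin r // j < m}, Set.range (s j.1))) : Set ℂ))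
    (hq2 : ∀ a, Module.finrank ℚ (kq a) = 2) (hE : ∀ a, IsCMTypeRealisation (Ψ a) (E a) (ιE a) (θE a))
    (hni : ∀ a b, a ≠ b → ¬ AbelianVariety.IsIsogenous (E a) (E b)) (hr : 0 < r) {N : ℕ} (π : Fin N → Fin r ⊕ I) :
    HodgeConjectureFor (⨁ fun j => (Sum.elim T E (π j) : AbelianVariety ℂ)).dim (⨁ fun j => (Sum.elim T E (π j) : AbelianVariety ℂ)).X := by
  -- the fields of two distinct curves are not isomorphic
  have hkk : ∀ a b, a ≠ b → IsEmpty (kq a →+* kq b) := fun a b hab => ⟨fun f => by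
    obtain ⟨e⟩ := exists_ringEquiv_of_ringHom_of_finrank_eq f ((hq2 a).trans (hq2 b).symm)
    exact hni a b hab (isIsogenous_of_ringEquiv (hq2 b) (hE b) (hE a) e).symm'⟩
  -- a curve field not `≅ k` embeds in no `K_m`
  have hforK : ∀ a m, IsEmpty (kq a →+* k) → IsEmpty (kq a →+* K m) := fun a m ha => ⟨fun f => by
    obtain ⟨e⟩ := WeilFibre.nonempty_algEquiv_of_finrank_eq_two (M := K m) (hq2 a) h2 (by rw [h6 m]; decide) f.toRatAlgHom (i m).toRatAlgHom
    exact ha.false e.toRingEquiv.toRingHom⟩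
  by_cases hfor : ∃ a, IsEmpty (kq a →+* k)
  swap
  · exact hodgeConjectureFor_prod_sum_tower_of_forall_ringHom_of_markman hW4 h2 h6 i hT hS τ s hs htower hq2 hE hni hr π fun l c _ =>
      not_isEmpty_iff.1 fun h => hfor ⟨c, h⟩
  obtain ⟨a₀, ha₀⟩ := hfor
  haveI : Nonempty I := ⟨a₀⟩
  -- the family over `Fin r ⊕ I` (all identifications below are definitional)
  let Kf : Fin r ⊕ I → Type := Sum.elim K kq
  letI instF : ∀ x, Field (Kf x) := fun x => @Sum.rec (Fin r) I (fun x => Field (Sum.elim K kq x)) (fun m => fK m) (fun a => fq a) x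
  letI instN : ∀ x, NumberField (Kf x) := fun x => @Sum.rec (Fin r) I (fun x => NumberField (Sum.elim K kq x)) (fun m => nK m) (fun a => nq a) x
  haveI instC : ∀ x, IsCMField (Kf x) := fun x => @Sum.rec (Fin r) I (fun x => IsCMField (Sum.elim K kq x)) (fun m => cK m) (fun a => cq a) x
  let Φf : ∀ x, CMType (Kf x) := fun x => @Sum.rec (Fin r) I (fun x => CMType (Sum.elim K kq x)) (fun m => Φ m) (fun a => Ψ a) x
  let ιf : ∀ x, 𝓞 (Kf x) →+* End (Sum.elim T E x : AbelianVariety ℂ) :=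
    fun x => @Sum.rec (Fin r) I (fun x => 𝓞 (Sum.elim K kq x) →+* End (Sum.elim T E x : AbelianVariety ℂ)) (fun m => ι m) (fun a => ιE a) x
  let θf : ∀ x, Kf x →+* Module.End ℂ (complexBetti (Sum.elim T E x : AbelianVariety ℂ).X 1) :=
    fun x => @Sum.rec (Fin r) I (fun x => Sum.elim K kq x →+* Module.End ℂ (complexBetti (Sum.elim T E x : AbelianVariety ℂ).X 1)) (fun m => θ m) (fun a => θE a) x
  have hAf : ∀ x, IsCMTypeRealisation (Φf x) (Sum.elim T E x : AbelianVariety ℂ) (ιf x) (θf x) := by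
    rintro (m | a)
    · exact hT m
    · exact hE a
  refine @hodgeConjectureFor_prod_of_foreignCurves (Fin r ⊕ I) _ Kf instF instN instC Φf (fun x => (Sum.elim T E x : AbelianVariety ℂ)) ιf θf hAf
    (fun x => ∃ a, x = Sum.inr a ∧ IsEmpty (kq a →+* k)) _ ?_ ?_ ⟨Sum.inr a₀, a₀, rfl, ha₀⟩
    ⟨Sum.inl ⟨0, hr⟩, by rintro ⟨a, h, -⟩; exact Sum.inl_ne_inr h⟩ ?_ ?_ N π
  · rintro _ ⟨a, rfl, -⟩
    exact hq2 a
  · rintro _ t ⟨a, rfl, ha⟩ ht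
    rcases t with m | b
    · exact hforK a m ha
    · have hab : a ≠ b := by
        rintro rfl
        exact ht ⟨a, rfl, ha⟩
      exact hkk a b hab
  · -- products of copies of the foreign curves (b16, unconditional)
    intro M ρ hρ
    choose a ha using hρ
    have hfun : (fun l => (Sum.elim T E (ρ l) : AbelianVariety ℂ)) = fun l => E (a l) := funext fun l => by rw [(ha l).1]; rfl
    rw [hfun]
    exact hodgeConjectureFor_prod_of_pairwise_not_isIsogenous hq2 hE hni a
  · -- the rest block: §1
    intro M ρ hρ
    exact hodgeConjectureFor_prod_sum_tower_of_forall_ringHom_of_markman hW4 h2 h6 i hT hS τ s hs htower hq2 hE hni hr ρ fun l c h =>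
      not_isEmpty_iff.1 fun hc => hρ l ⟨c, h, hc⟩

/-! ## §3 Any finite family of CM elliptic curves -/

/-- **MAIN THEOREM — A CUBIC TOWER OF SIMPLE CM THREEFOLDS OVER `k` AND ANY FINITE FAMILY OF CM ELLIPTIC CURVES, given ONLY Markman's fourfold theorem.**  `k` imaginary
quadratic, `T_m ⊨ (K_m; Φ_m)` (`m < r`, `r ≥ 1`) SIMPLE CM threefolds with `i_m : k ↪ K_m` in a cubic tower (`htower`), `E_c ⊨ (k_c; Ψ_c)` (`c ∈ I`, finite) CM elliptic curves —
isogenous or not, of ANY fields.  Then for every `π : Fin N → Fin r ⊕ I` the Hodge conjecture holds for `⨁_j Sum.elim T E (π j)` — every `∏_m T_m^{b_m} × ∏_c E_c^{n_c}` — GIVEN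
ONLY `Markman2025_weilClasses_algebraic_abelianFourfold` (one representative per isogeny class of curves, §2, then the isogeny).  In particular: ANY two simple CM threefolds
over NON-ISOMORPHIC sextic fields containing `k` with any curves (gen 31's `Hom(K₁,K₀) = ∅ ⟹ tower`) — but that case is already inside the two-threefold roof.  `HC_CM` is NOT
asserted. [cite: MoonenZarhin1999LowDim, Thm. (0.1) (a), §3 (3.1), Cor. (3.9)] [cite: Markman2025SurveySecant, Thm. 1.2] [cite: MumfordAV1970, §19 Thm. 1 and p. 169] -/
theorem hodgeConjectureFor_prod_simpleThreefolds_of_cubicTower_anyCurves_of_markman (hW4 : Markman2025_weilClasses_algebraic_abelianFourfold)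
    (h2 : Module.finrank ℚ k = 2) (h6 : ∀ m, Module.finrank ℚ (K m) = 6) (i : ∀ m, k →+* K m) (hT : ∀ m, IsCMTypeRealisation (Φ m) (T m) (ι m) (θ m))
    (hS : ∀ m, (T m).IsSimple) (τ : k →+* ℂ) (s : ∀ m, K m →+* ℂ) (hs : ∀ m, (s m).comp (i m) = τ)
    (htower : ∀ (m : Fin r) (φ : K m →+* ℂ), φ.comp (i m) = τ →
      ¬ Set.range φ ⊆ (↑(adjoin ℚ (Set.range τ) ⊔ adjoin ℚ (⋃ j : {j : Fin r // j < m}, Set.range (s j.1))) : Set ℂ))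
    (hq2 : ∀ a, Module.finrank ℚ (kq a) = 2) (hE : ∀ a, IsCMTypeRealisation (Ψ a) (E a) (ιE a) (θE a)) (hr : 0 < r) {N : ℕ} (π : Fin N → Fin r ⊕ I) :
    HodgeConjectureFor (⨁ fun j => (Sum.elim T E (π j) : AbelianVariety ℂ)).dim (⨁ fun j => (Sum.elim T E (π j) : AbelianVariety ℂ)).X := by
  -- an auxiliary linear order on `I`, and the least index of each isogeny class as its representative
  letI : LinearOrder I := LinearOrder.lift' (Fintype.equivFin I) (Fintype.equivFin I).injective
  let cl : I → Finset I := fun a => Finset.univ.filter fun b => AbelianVariety.IsIsogenous (E a) (E b)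
  have hcl : ∀ a b, b ∈ cl a ↔ AbelianVariety.IsIsogenous (E a) (E b) := fun a b => by
    simp only [cl, Finset.mem_filter, Finset.mem_univ, true_and]
  have hne : ∀ a, (cl a).Nonempty := fun a => ⟨a, (hcl a a).2 (AbelianVariety.IsIsogenous.refl (E a))⟩
  let rep : I → I := fun a => (cl a).min' (hne a)
  have hr_iso : ∀ a, AbelianVariety.IsIsogenous (E a) (E (rep a)) := fun a => (hcl a (rep a)).1 (Finset.min'_mem _ (hne a))
  have hr_le : ∀ a b, AbelianVariety.IsIsogenous (E a) (E b) → rep a ≤ rep b := fun a b h =>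
    Finset.min'_le (cl a) (rep b) ((hcl a (rep b)).2 (h.trans (hr_iso b)))
  have hr_eq : ∀ a b, AbelianVariety.IsIsogenous (E a) (E b) → rep a = rep b := fun a b h => le_antisymm (hr_le a b h) (hr_le b a h.symm')
  have hr_idem : ∀ a, rep (rep a) = rep a := fun a => (hr_eq a (rep a) (hr_iso a)).symm
  let J : Type := {b : I // rep b = b}
  have hniJ : ∀ j j' : J, j ≠ j' → ¬ AbelianVariety.IsIsogenous (E j.1) (E j'.1) := fun j j' hne' h =>
    hne' (Subtype.ext (by rw [← j.2, ← j'.2]; exact hr_eq _ _ h))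
  let ρ : I → J := fun a => ⟨rep a, hr_idem a⟩
  have hiso : AbelianVariety.IsIsogenous (⨁ fun l => (Sum.elim T E (π l) : AbelianVariety ℂ))
      (⨁ fun l => (Sum.elim T (fun j : J => E j.1) ((π l).map id ρ) : AbelianVariety ℂ)) := by
    refine AbelianVariety.IsIsogenous.biproduct fun l => ?_
    show AbelianVariety.IsIsogenous (Sum.elim T E (π l)) (Sum.elim T (fun j : J => E j.1) ((π l).map id ρ))
    rcases π l with m | a
    · exact AbelianVariety.IsIsogenous.refl _
    · exact hr_iso a
  exact Domination.hodgeConjectureFor_of_avDominatedBy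
    (hodgeConjectureFor_prod_simpleThreefolds_of_cubicTower_cmCurves_of_markman (kq := fun j : J => kq j.1) (E := fun j : J => E j.1) (Ψ := fun j : J => Ψ j.1)
      (ιE := fun j : J => ιE j.1) (θE := fun j : J => θE j.1) hW4 h2 h6 i hT hS τ s hs htower (fun j => hq2 j.1) (fun j => hE j.1) hniJ hr fun l => (π l).map id ρ)
    (Domination.AVDominatedBy.of_isIsogenous hiso (Domination.AVDominatedBy.refl _))

/-- **Dominated form**: everything dominated by a product of copies of the tower and any CM elliptic curves, given only Markman's fourfold theorem.
[cite: MoonenZarhin1999LowDim, Thm. (0.1) (a)] [cite: Markman2025SurveySecant, Thm. 1.2] [cite: MumfordAV1970, §19 Thm. 1 and p. 169] -/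
theorem hodgeConjectureFor_of_avDominatedBy_prod_simpleThreefolds_of_cubicTower_anyCurves_of_markman (hW4 : Markman2025_weilClasses_algebraic_abelianFourfold)
    (h2 : Module.finrank ℚ k = 2) (h6 : ∀ m, Module.finrank ℚ (K m) = 6) (i : ∀ m, k →+* K m) (hT : ∀ m, IsCMTypeRealisation (Φ m) (T m) (ι m) (θ m))
    (hS : ∀ m, (T m).IsSimple) (τ : k →+* ℂ) (s : ∀ m, K m →+* ℂ) (hs : ∀ m, (s m).comp (i m) = τ)
    (htower : ∀ (m : Fin r) (φ : K m →+* ℂ), φ.comp (i m) = τ →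
      ¬ Set.range φ ⊆ (↑(adjoin ℚ (Set.range τ) ⊔ adjoin ℚ (⋃ j : {j : Fin r // j < m}, Set.range (s j.1))) : Set ℂ))
    (hq2 : ∀ a, Module.finrank ℚ (kq a) = 2) (hE : ∀ a, IsCMTypeRealisation (Ψ a) (E a) (ιE a) (θE a)) (hr : 0 < r) {N : ℕ} (π : Fin N → Fin r ⊕ I)
    {X : AbelianVariety ℂ} (hX : Domination.AVDominatedBy X (⨁ fun j => (Sum.elim T E (π j) : AbelianVariety ℂ))) : HodgeConjectureFor X.dim X.X :=
  Domination.hodgeConjectureFor_of_avDominatedBy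
    (hodgeConjectureFor_prod_simpleThreefolds_of_cubicTower_anyCurves_of_markman hW4 h2 h6 i hT hS τ s hs htower hq2 hE hr π) hX

end TowerCurves

end Summit.HodgeConjecture.CorCM.MultiFieldWeil

end
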